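import Mathlib
import HarnessLib
import Literature.NumberTheory.DiophantineGeometry.RothPrelim
import Literature.NumberTheory.DiophantineGeometry.RothTaylor

/-!
# Roth's theorem after Schmidt (LNM 785, Ch. V) — tools for Roth's Lemma: change of variables,
separated variables, slices, the minimal index

Source: W. M. Schmidt, *Diophantine Approximation*, LNM 785 (1980), Ch. V §10 (proof of
Theorem 10A and Lemma 10B) [Schmidt1980].

The proof of Roth's Lemma works in `ℤ[X₁, …, X_m]` but handles polynomials `V(X₁, …, X_{m-1})`
and `U(X_m)` "considered as polynomials in `X₁, …, X_m`" and their product `W = V·U`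
(pp. 131–132). This file provides that bookkeeping for `Roth.hasseD` / `Roth.IndexGe`:

* transport of `P_i`, of the weighted order and of `IndexGe` along an injective renaming of the
  variables (`hasseD_rename_mapDomain`, `indexGe_rename_iff`);
* products in separated variables: `(V̂·Û)_{x̂+ŷ} = V̂_x̂ · Û_ŷ` and the resulting exact
  splitting of coefficients (`hasseD_sep_mul`, `coeff_sep_mul`) — the "easy direction" of
  Lemma 6A (iii) used in Lemma 10B (`Ind W ≤ Ind V* + Ind U*`);
* for `m + 1` variables with the last one distinguished: `Roth.snocF`/`Roth.initF` on exponents,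
  the slices `Roth.sliceLast ν W` (the coefficient of `X_last^ν`, a polynomial in the first `m`
  variables) and `Roth.sliceFirst κ W` (the coefficient of `X'^κ`, a polynomial in `X_last`), the
  reconstruction `W = Σ_ν sliceLast ν W · X_last^ν`, and the slices of a product in separated
  variables (scalar multiples of the factors);
* the minimal weighted order of a non-vanishing `P_i(a)` (`exists_min_wt`), i.e. Schmidt's
  numerical index `θ` of a non-zero `P` together with `Ind P ≥ θ`.

## References

* [Schmidt1980] W. M. Schmidt, *Diophantine Approximation*, LNM 785, Springer 1980, Ch. V §10.
-/

noncomputable section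

open MvPolynomial Finset

namespace Literature.NumberTheory.DiophantineGeometry

namespace Roth

/-! ### Transport along an injective renaming of variables -/

section Rename

variable {σ τ : Type*} {R : Type*} [CommSemiring R] {f : σ → τ}

/-- A multi-index supported outside the range of `f` never occurs in `rename f Q`. [folklore] -/
theorem coeff_rename_eq_zero_of_not_subset (Q : MvPolynomial σ R) {d : τ →₀ ℕ} {t : τ}
    (ht : t ∈ d.support) (htf : t ∉ Set.range f) : coeff d (rename f Q) = 0 := by
  apply coeff_rename_eq_zero
  intro u hu
  exfalso
  rw [Finsupp.mem_support_iff] at ht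
  apply ht
  rw [← hu, Finsupp.mapDomain_notin_range _ _ htf]

/-- `P_i` of a renamed polynomial, for `i` in the range: `(rename f Q)_{f̂ j} = rename f (Q_j)`.
[folklore] -/
theorem hasseD_rename_mapDomain (hf : Function.Injective f) (j : σ →₀ ℕ) (Q : MvPolynomial σ R) :
    hasseD (Finsupp.mapDomain f j) (rename f Q) = rename f (hasseD j Q) := by
  classical
  ext k
  rw [coeff_hasseD]
  rcases Classical.em ((k.support : Set τ) ⊆ Set.range f) with hk | hk
  · obtain ⟨u, rfl⟩ : ∃ u, Finsupp.mapDomain f u = k :=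
      ⟨_, Finsupp.mapDomain_comapDomain f hf k hk⟩
    rw [coeff_rename_mapDomain f hf, coeff_hasseD, ← Finsupp.mapDomain_add,
      coeff_rename_mapDomain f hf, Finsupp.prod_mapDomain_index_inj hf]
    congr 2
    exact Finsupp.prod_congr fun x _ => by rw [Finsupp.mapDomain_apply hf]
  · rw [Set.not_subset] at hk
    obtain ⟨t, ht, htf⟩ := hk
    have h1 : coeff (k + Finsupp.mapDomain f j) (rename f Q) = 0 := by
      apply coeff_rename_eq_zero_of_not_subset Q _ htf
      rw [Finsupp.mem_support_iff, Finsupp.add_apply, Finsupp.mapDomain_notin_range _ _ htf,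
        add_zero]
      exact Finsupp.mem_support_iff.mp ht
    rw [h1, mul_zero, coeff_rename_eq_zero_of_not_subset _ ht htf]

/-- `P_i` of a renamed polynomial vanishes for `i` not supported in the range. [folklore] -/
theorem hasseD_rename_eq_zero (Q : MvPolynomial σ R) {i : τ →₀ ℕ} {t : τ} (ht : t ∈ i.support)
    (htf : t ∉ Set.range f) : hasseD i (rename f Q) = 0 := by
  classical
  ext k
  rw [coeff_hasseD, coeff_zero, coeff_rename_eq_zero_of_not_subset Q _ htf, mul_zero]
  rw [Finsupp.mem_support_iff, Finsupp.add_apply]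
  have := Finsupp.mem_support_iff.mp ht
  omega

variable [Fintype σ] [Fintype τ]

/-- The weighted order as a `Finsupp.sum`. [folklore] -/
theorem wt_eq_finsuppSum (r : τ → ℕ) (i : τ →₀ ℕ) :
    wt r i = i.sum fun t n => (n : ℝ) / r t := by
  rw [wt, Finsupp.sum_fintype]
  intro t; simp

/-- The weighted order is invariant under injective renaming (weights pulled back). [folklore] -/
theorem wt_mapDomain (hf : Function.Injective f) (r : τ → ℕ) (j : σ →₀ ℕ) :
    wt r (Finsupp.mapDomain f j) = wt (r ∘ f) j := by
  rw [wt_eq_finsuppSum, wt_eq_finsuppSum, Finsupp.sum_mapDomain_index_inj hf]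
  rfl

variable {S : Type*} [CommRing S] {A : Type*} [CommRing A] [Algebra S A]

/-- **Transport of the index** along an injective renaming: the index of `rename f Q` at `a`
w.r.t. `r` is the index of `Q` at `a ∘ f` w.r.t. `r ∘ f` (Schmidt: "if we consider `V*` as a
polynomial in `X₁, …, X_m`, then `V*` still has index …", p. 132).
[cite: Schmidt1980, Ch. V proof of Lemma 10B] -/
theorem indexGe_rename_iff (hf : Function.Injective f) (Q : MvPolynomial σ S) (a : τ → A)
    (r : τ → ℕ) (t : ℝ) :
    IndexGe (rename f Q) a r t ↔ IndexGe Q (a ∘ f) (r ∘ f) t := by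
  constructor
  · intro h j hj
    have := h (Finsupp.mapDomain f j) (by rwa [wt_mapDomain hf])
    rwa [hasseD_rename_mapDomain hf, aeval_rename] at this
  · intro h i hi
    rcases Classical.em ((i.support : Set τ) ⊆ Set.range f) with hs | hs
    · obtain ⟨u, rfl⟩ : ∃ u, Finsupp.mapDomain f u = i :=
        ⟨_, Finsupp.mapDomain_comapDomain f hf i hs⟩
      rw [hasseD_rename_mapDomain hf, aeval_rename]
      exact h u (by rwa [wt_mapDomain hf] at hi)
    · rw [Set.not_subset] at hs
      obtain ⟨t, ht, htf⟩ := hs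
      rw [hasseD_rename_eq_zero Q ht htf, map_zero]

/-- Transport of an upper bound for the index along an injective renaming. [folklore] -/
theorem exists_wt_le_rename (hf : Function.Injective f) (Q : MvPolynomial σ S) (a : τ → A)
    (r : τ → ℕ) {s : ℝ} (h : ∃ j, wt (r ∘ f) j ≤ s ∧ aeval (a ∘ f) (hasseD j Q) ≠ 0) :
    ∃ i, wt r i ≤ s ∧ aeval a (hasseD i (rename f Q)) ≠ 0 := by
  obtain ⟨j, hj, hne⟩ := h
  refine ⟨Finsupp.mapDomain f j, by rwa [wt_mapDomain hf], ?_⟩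
  rwa [hasseD_rename_mapDomain hf, aeval_rename]

end Rename

/-! ### Products in separated variables -/

section Separated

variable {σ₁ σ₂ τ : Type*} {f : σ₁ → τ} {g : σ₂ → τ}

/-- Uniqueness of the splitting of a multi-index into parts supported on two disjoint sets of
variables. [folklore] -/
theorem split_unique (hfg : ∀ a b, f a ≠ g b) {x x' y y' : τ →₀ ℕ}
    (hx : (x.support : Set τ) ⊆ Set.range f) (hx' : (x'.support : Set τ) ⊆ Set.range f)
    (hy : (y.support : Set τ) ⊆ Set.range g) (hy' : (y'.support : Set τ) ⊆ Set.range g)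
    (h : x + y = x' + y') : x = x' ∧ y = y' := by
  have key : ∀ t, x t = x' t ∧ y t = y' t := by
    intro t
    have ht := DFunLike.congr_fun h t
    simp only [Finsupp.coe_add, Pi.add_apply] at ht
    have zero_of : ∀ (z : τ →₀ ℕ) (S : Set τ), (z.support : Set τ) ⊆ S → t ∉ S → z t = 0 := by
      intro z S hz htS
      by_contra hne
      exact htS (hz (Finsupp.mem_support_iff.mpr hne))
    rcases Classical.em (t ∈ Set.range f) with htf | htf
    · have htg : t ∉ Set.range g := by
        rintro ⟨b, rfl⟩; obtain ⟨a, ha⟩ := htf; exact hfg a b ha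
      have := zero_of y _ hy htg; have := zero_of y' _ hy' htg
      constructor <;> omega
    · have := zero_of x _ hx htf; have := zero_of x' _ hx' htf
      constructor <;> omega
  exact ⟨Finsupp.ext fun t => (key t).1, Finsupp.ext fun t => (key t).2⟩

/-- The support of a pushed-forward multi-index lies in the range. [folklore] -/
theorem support_mapDomain_subset_range {α : Type*} (h : α → τ) (x : α →₀ ℕ) :
    ((Finsupp.mapDomain h x).support : Set τ) ⊆ Set.range h := by
  classical
  intro t ht
  by_contra hnot
  exact (Finsupp.mem_support_iff.mp ht) (Finsupp.mapDomain_notin_range _ _ hnot)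

variable [Fintype τ] [DecidableEq τ]

/-- **Derivatives of a product in separated variables**:
`(V̂ Û)_{f̂x + ĝy} = rename f (V_x) · rename g (U_y)` for `V̂ = rename f V`, `Û = rename g U` with
`f`, `g` injective of disjoint ranges. [cite: Schmidt1980, Ch. V proof of Theorem 10A (W = V·U)] -/
theorem hasseD_sep_mul {R : Type*} [CommRing R] (hf : Function.Injective f)
    (hg : Function.Injective g) (hfg : ∀ a b, f a ≠ g b) (x : σ₁ →₀ ℕ) (y : σ₂ →₀ ℕ)
    (V : MvPolynomial σ₁ R) (U : MvPolynomial σ₂ R) :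
    hasseD (Finsupp.mapDomain f x + Finsupp.mapDomain g y) (rename f V * rename g U) =
      rename f (hasseD x V) * rename g (hasseD y U) := by
  rw [hasseD_mul, Finset.sum_eq_single (Finsupp.mapDomain f x, Finsupp.mapDomain g y)]
  · rw [hasseD_rename_mapDomain hf, hasseD_rename_mapDomain hg]
  · rintro ⟨x', y'⟩ hmem hne
    rw [Finset.HasAntidiagonal.mem_antidiagonal] at hmem
    rcases Classical.em ((x'.support : Set τ) ⊆ Set.range f) with hx' | hx'
    · rcases Classical.em ((y'.support : Set τ) ⊆ Set.range g) with hy' | hy'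
      · exfalso
        obtain ⟨h1, h2⟩ := split_unique hfg hx' (support_mapDomain_subset_range f x) hy'
          (support_mapDomain_subset_range g y) hmem
        exact hne (Prod.ext h1 h2)
      · rw [Set.not_subset] at hy'
        obtain ⟨t, ht, htg⟩ := hy'
        rw [hasseD_rename_eq_zero U ht htg, mul_zero]
    · rw [Set.not_subset] at hx'
      obtain ⟨t, ht, htf⟩ := hx'
      rw [hasseD_rename_eq_zero V ht htf, zero_mul]
  · intro h
    exact (h (Finset.HasAntidiagonal.mem_antidiagonal.mpr rfl)).elim

omit [Fintype τ] in
/-- **Coefficients of a product in separated variables**: the coefficient of `X^{f̂μ + ĝν}` in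
`V̂ Û` is `v_μ u_ν`. [folklore] -/
theorem coeff_sep_mul {R : Type*} [CommSemiring R] (hf : Function.Injective f)
    (hg : Function.Injective g) (hfg : ∀ a b, f a ≠ g b) (μ : σ₁ →₀ ℕ) (ν : σ₂ →₀ ℕ)
    (V : MvPolynomial σ₁ R) (U : MvPolynomial σ₂ R) :
    coeff (Finsupp.mapDomain f μ + Finsupp.mapDomain g ν) (rename f V * rename g U) =
      coeff μ V * coeff ν U := by
  rw [coeff_mul, Finset.sum_eq_single (Finsupp.mapDomain f μ, Finsupp.mapDomain g ν)]
  · rw [coeff_rename_mapDomain f hf, coeff_rename_mapDomain g hg]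
  · rintro ⟨x', y'⟩ hmem hne
    rw [Finset.HasAntidiagonal.mem_antidiagonal] at hmem
    rcases Classical.em ((x'.support : Set τ) ⊆ Set.range f) with hx' | hx'
    · rcases Classical.em ((y'.support : Set τ) ⊆ Set.range g) with hy' | hy'
      · exfalso
        obtain ⟨h1, h2⟩ := split_unique hfg hx' (support_mapDomain_subset_range f μ) hy'
          (support_mapDomain_subset_range g ν) hmem
        exact hne (Prod.ext h1 h2)
      · rw [Set.not_subset] at hy'
        obtain ⟨t, ht, htg⟩ := hy'
        rw [coeff_rename_eq_zero_of_not_subset U ht htg, mul_zero]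
    · rw [Set.not_subset] at hx'
      obtain ⟨t, ht, htf⟩ := hx'
      rw [coeff_rename_eq_zero_of_not_subset V ht htf, zero_mul]
  · intro h
    exact (h (Finset.HasAntidiagonal.mem_antidiagonal.mpr rfl)).elim

/-- Non-vanishing of derivatives of a product in separated variables at a point (the "easy
direction" of Lemma 6A (iii), giving `Ind W ≤ Ind V* + Ind U*` in Lemma 10B).
[cite: Schmidt1980, Ch. V proof of Lemma 10B] -/
theorem aeval_hasseD_sep_mul_ne_zero {R : Type*} [CommRing R] {A : Type*} [CommRing A]
    [IsDomain A] [Algebra R A]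
    (hf : Function.Injective f) (hg : Function.Injective g) (hfg : ∀ a b, f a ≠ g b)
    (a : τ → A) {x : σ₁ →₀ ℕ} {y : σ₂ →₀ ℕ} {V : MvPolynomial σ₁ R} {U : MvPolynomial σ₂ R}
    (hV : aeval (a ∘ f) (hasseD x V) ≠ 0) (hU : aeval (a ∘ g) (hasseD y U) ≠ 0) :
    aeval a (hasseD (Finsupp.mapDomain f x + Finsupp.mapDomain g y) (rename f V * rename g U)) ≠ 0 := by
  rw [hasseD_sep_mul hf hg hfg, map_mul, aeval_rename, aeval_rename]
  exact mul_ne_zero hV hU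

end Separated

/-! ### `m + 1` variables with the last one distinguished -/

section Last

variable {m : ℕ} {R : Type*} [CommSemiring R]

/-- Append a last exponent: `snocF κ ν = (κ₀, …, κ_{m-1}, ν)`. [folklore] -/
def snocF (κ : Fin m →₀ ℕ) (ν : ℕ) : Fin (m + 1) →₀ ℕ :=
  Finsupp.equivFunOnFinite.symm (Fin.snoc (⇑κ) ν)

/-- Drop the last exponent. [folklore] -/
def initF (J : Fin (m + 1) →₀ ℕ) : Fin m →₀ ℕ :=
  Finsupp.equivFunOnFinite.symm (Fin.init (⇑J))

/-- `snocF_castSucc`. [folklore] -/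
@[simp] theorem snocF_castSucc (κ : Fin m →₀ ℕ) (ν : ℕ) (h : Fin m) :
    snocF κ ν h.castSucc = κ h := by
  simp [snocF]

/-- `snocF_last`. [folklore] -/
@[simp] theorem snocF_last (κ : Fin m →₀ ℕ) (ν : ℕ) : snocF κ ν (Fin.last m) = ν := by
  simp [snocF]

/-- `initF_apply`. [folklore] -/
@[simp] theorem initF_apply (J : Fin (m + 1) →₀ ℕ) (h : Fin m) : initF J h = J h.castSucc := by
  simp [initF, Fin.init]

/-- `initF_snocF`. [folklore] -/
@[simp] theorem initF_snocF (κ : Fin m →₀ ℕ) (ν : ℕ) : initF (snocF κ ν) = κ := by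
  ext h; simp

/-- `snocF_initF`. [folklore] -/
@[simp] theorem snocF_initF (J : Fin (m + 1) →₀ ℕ) : snocF (initF J) (J (Fin.last m)) = J := by
  ext t
  refine Fin.lastCases ?_ (fun h => ?_) t
  · simp
  · rw [snocF_castSucc, initF_apply]

/-- `snocF κ ν = f̂κ + ν e_last` with `f = Fin.castSucc`. [folklore] -/
theorem snocF_eq_mapDomain_add (κ : Fin m →₀ ℕ) (ν : ℕ) :
    snocF κ ν = Finsupp.mapDomain Fin.castSucc κ +
      Finsupp.mapDomain (fun _ : Fin 1 => Fin.last m) (Finsupp.single 0 ν) := by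
  classical
  ext t
  rw [Finsupp.add_apply, Finsupp.mapDomain_single]
  refine Fin.lastCases ?_ (fun h => ?_) t
  · rw [snocF_last, Finsupp.single_eq_same, Finsupp.mapDomain_notin_range]
    · simp
    · rintro ⟨h, hh⟩; exact (Fin.castSucc_lt_last h).ne hh
  · rw [snocF_castSucc, Finsupp.mapDomain_apply (Fin.castSucc_injective m),
      Finsupp.single_eq_of_ne (Fin.castSucc_lt_last h).ne, add_zero]

/-- `snocF_injective`. [folklore] -/
theorem snocF_injective : Function.Injective fun p : (Fin m →₀ ℕ) × ℕ => snocF p.1 p.2 := by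
  rintro ⟨κ, ν⟩ ⟨κ', ν'⟩ h
  have h1 := congrArg initF h
  have h2 := DFunLike.congr_fun h (Fin.last m)
  simp only [initF_snocF, snocF_last] at h1 h2
  rw [h1, h2]

/-- The weighted order of `snocF κ ν`. [folklore] -/
theorem wt_snocF (r : Fin (m + 1) → ℕ) (κ : Fin m →₀ ℕ) (ν : ℕ) :
    wt r (snocF κ ν) = wt (fun h => r h.castSucc) κ + (ν : ℝ) / r (Fin.last m) := by
  rw [wt, wt, Fin.sum_univ_castSucc]
  simp

/-- The coefficient of `X_last^ν` in `W`, a polynomial in the first `m` variables (Schmidt's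
decomposition `P = Σ_j φ_j(X₁,…,X_{m-1}) ψ_j(X_m)` starts from these).
[cite: Schmidt1980, Ch. V (10.8)] -/
def sliceLast (ν : ℕ) (W : MvPolynomial (Fin (m + 1)) R) : MvPolynomial (Fin m) R :=
  ∑ J ∈ W.support with J (Fin.last m) = ν, monomial (initF J) (coeff J W)

/-- The coefficient of `X'^κ` in `W`, a polynomial in the last variable (indexed by `Fin 1`).
[cite: Schmidt1980, Ch. V (10.8)] -/
def sliceFirst (κ : Fin m →₀ ℕ) (W : MvPolynomial (Fin (m + 1)) R) : MvPolynomial (Fin 1) R :=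
  ∑ J ∈ W.support with initF J = κ, monomial (Finsupp.single 0 (J (Fin.last m))) (coeff J W)

/-- `coeff_sliceLast`. [folklore] -/
theorem coeff_sliceLast (ν : ℕ) (W : MvPolynomial (Fin (m + 1)) R) (κ : Fin m →₀ ℕ) :
    coeff κ (sliceLast ν W) = coeff (snocF κ ν) W := by
  classical
  rw [sliceLast, coeff_sum]
  simp only [coeff_monomial]
  rw [Finset.sum_eq_single (snocF κ ν)]
  · simp only [initF_snocF, if_true]
  · intro J hJ hne
    rw [if_neg]
    intro h
    rw [Finset.mem_filter] at hJ
    apply hne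
    rw [← h, ← hJ.2, snocF_initF]
  · intro h
    rw [Finset.mem_filter, not_and] at h
    by_cases hs : snocF κ ν ∈ W.support
    · exact absurd (snocF_last κ ν) (h hs)
    · simp [notMem_support_iff.mp hs]

/-- `coeff_sliceFirst`. [folklore] -/
theorem coeff_sliceFirst (κ : Fin m →₀ ℕ) (W : MvPolynomial (Fin (m + 1)) R) (ν : ℕ) :
    coeff (Finsupp.single 0 ν) (sliceFirst κ W) = coeff (snocF κ ν) W := by
  classical
  rw [sliceFirst, coeff_sum]
  simp only [coeff_monomial]
  rw [Finset.sum_eq_single (snocF κ ν)]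
  · simp only [snocF_last, if_true]
  · intro J hJ hne
    rw [if_neg]
    intro h
    rw [Finset.mem_filter] at hJ
    apply hne
    have hν : J (Fin.last m) = ν := by
      have := DFunLike.congr_fun h 0
      simpa using this
    rw [← hν, ← hJ.2, snocF_initF]
  · intro h
    rw [Finset.mem_filter, not_and] at h
    by_cases hs : snocF κ ν ∈ W.support
    · exact absurd (initF_snocF κ ν) (h hs)
    · simp [notMem_support_iff.mp hs]

/-- Every coefficient of a polynomial in `Fin 1` variables is indexed by `single 0 ν`. [folklore] -/
theorem finsupp_fin_one_eq (i : Fin 1 →₀ ℕ) : i = Finsupp.single 0 (i 0) := by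
  refine Finsupp.ext fun t => ?_
  fin_cases t; simp

/-- A multi-index on `Fin 1` as a push-forward. [folklore] -/
theorem mapDomain_const_single {τ : Type*} (t₀ : τ) (ν : ℕ) :
    Finsupp.mapDomain (fun _ : Fin 1 => t₀) (Finsupp.single 0 ν) = Finsupp.single t₀ ν := by
  classical
  rw [Finsupp.mapDomain_single]

/-- Slices commute with a change of coefficients. [folklore] -/
theorem map_sliceLast {S : Type*} [CommSemiring S] (φ : R →+* S) (ν : ℕ)
    (W : MvPolynomial (Fin (m + 1)) R) : map φ (sliceLast ν W) = sliceLast ν (map φ W) := by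
  ext κ
  rw [coeff_map, coeff_sliceLast, coeff_sliceLast, coeff_map]

/-- `map_sliceFirst`. [folklore] -/
theorem map_sliceFirst {S : Type*} [CommSemiring S] (φ : R →+* S) (κ : Fin m →₀ ℕ)
    (W : MvPolynomial (Fin (m + 1)) R) : map φ (sliceFirst κ W) = sliceFirst κ (map φ W) := by
  ext i
  rw [finsupp_fin_one_eq i, coeff_map, coeff_sliceFirst, coeff_sliceFirst, coeff_map]

/-- Degrees of a slice are bounded by those of `W`. [folklore] -/
theorem degreeOf_sliceLast_le (ν : ℕ) (W : MvPolynomial (Fin (m + 1)) R) (h : Fin m) :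
    degreeOf h (sliceLast ν W) ≤ degreeOf h.castSucc W := by
  rw [degreeOf_le_iff]
  intro κ hκ
  rw [mem_support_iff, coeff_sliceLast] at hκ
  have := monomial_le_degreeOf h.castSucc (mem_support_iff.mpr hκ)
  rwa [snocF_castSucc] at this

/-- `degreeOf_sliceFirst_le`. [folklore] -/
theorem degreeOf_sliceFirst_le (κ : Fin m →₀ ℕ) (W : MvPolynomial (Fin (m + 1)) R) :
    degreeOf 0 (sliceFirst κ W) ≤ degreeOf (Fin.last m) W := by
  rw [degreeOf_le_iff]
  intro i hi
  rw [finsupp_fin_one_eq i, mem_support_iff, coeff_sliceFirst] at hi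
  have := monomial_le_degreeOf (Fin.last m) (mem_support_iff.mpr hi)
  rw [snocF_last] at this
  rw [finsupp_fin_one_eq i, Finsupp.single_eq_same]
  exact this

/-- Heights of slices of an integer polynomial are bounded by the height. [folklore] -/
theorem height_sliceLast_le (ν : ℕ) (W : MvPolynomial (Fin (m + 1)) ℤ) :
    height (sliceLast ν W) ≤ height W := by
  rw [height_le_iff]; intro κ; rw [coeff_sliceLast]; exact natAbs_coeff_le_height W _

/-- `height_sliceFirst_le`. [folklore] -/
theorem height_sliceFirst_le (κ : Fin m →₀ ℕ) (W : MvPolynomial (Fin (m + 1)) ℤ) :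
    height (sliceFirst κ W) ≤ height W := by
  rw [height_le_iff]; intro i
  rw [finsupp_fin_one_eq i, coeff_sliceFirst]; exact natAbs_coeff_le_height W _

/-- **Reconstruction from the slices**: `W = Σ_{ν ≤ L} (sliceLast ν W)(X') · X_last^ν` when
`deg_{X_last} W ≤ L` (the decomposition (10.8) with `ψ_j = X_m^j`). [cite: Schmidt1980, Ch. V (10.8)] -/
theorem eq_sum_sliceLast (W : MvPolynomial (Fin (m + 1)) R) {L : ℕ}
    (hL : degreeOf (Fin.last m) W ≤ L) :
    W = ∑ ν ∈ Finset.range (L + 1),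
      rename Fin.castSucc (sliceLast ν W) * X (Fin.last m) ^ ν := by
  classical
  ext J
  rw [coeff_sum]
  have hterm : ∀ ν, coeff J (rename Fin.castSucc (sliceLast ν W) * X (Fin.last m) ^ ν) =
      if J (Fin.last m) = ν then coeff J W else 0 := by
    intro ν
    have hXpow : (X (Fin.last m) : MvPolynomial (Fin (m + 1)) R) ^ ν =
        rename (fun _ : Fin 1 => Fin.last m) (monomial (Finsupp.single 0 ν) 1) := by
      rw [rename_monomial, mapDomain_const_single, X_pow_eq_monomial]
    rw [hXpow]
    conv_lhs => rw [← snocF_initF J, snocF_eq_mapDomain_add]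
    rw [coeff_sep_mul (Fin.castSucc_injective m) (fun a b _ => Subsingleton.elim a b)
        (fun a _ h => (Fin.castSucc_lt_last a).ne h),
      coeff_sliceLast, coeff_monomial]
    by_cases h : J (Fin.last m) = ν
    · subst h
      rw [if_pos rfl, mul_one, snocF_initF, if_pos rfl]
    · rw [if_neg (fun h' => h (Finsupp.single_injective 0 h').symm), mul_zero, if_neg h]
  simp_rw [hterm]
  rw [Finset.sum_ite_eq]
  split_ifs with hmem
  · rfl
  · rw [Finset.mem_range, Nat.lt_succ_iff, not_le] at hmem
    rw [← notMem_support_iff]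
    intro hJ
    exact absurd ((monomial_le_degreeOf (Fin.last m) hJ).trans hL) (not_le.mpr hmem)

/-- **Slices of a product in separated variables**: the coefficient of `X_last^ν` in `V̂ Û` is
`u_ν · V`. [cite: Schmidt1980, Ch. V proof of Lemma 10B] -/
theorem sliceLast_sep_mul (V : MvPolynomial (Fin m) R) (U : MvPolynomial (Fin 1) R) (ν : ℕ) :
    sliceLast ν (rename Fin.castSucc V * rename (fun _ : Fin 1 => Fin.last m) U) =
      coeff (Finsupp.single 0 ν) U • V := by
  ext κ
  rw [coeff_sliceLast, snocF_eq_mapDomain_add,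
    coeff_sep_mul (Fin.castSucc_injective m) (fun a b _ => Subsingleton.elim a b)
      (fun a _ h => (Fin.castSucc_lt_last a).ne h),
    coeff_smul, smul_eq_mul, mul_comm]

/-- The coefficient of `X'^κ` in `V̂ Û` is `v_κ · U`. [cite: Schmidt1980, Ch. V proof of Lemma 10B] -/
theorem sliceFirst_sep_mul (V : MvPolynomial (Fin m) R) (U : MvPolynomial (Fin 1) R)
    (κ : Fin m →₀ ℕ) :
    sliceFirst κ (rename Fin.castSucc V * rename (fun _ : Fin 1 => Fin.last m) U) =
      coeff κ V • U := by
  ext i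
  rw [finsupp_fin_one_eq i, coeff_sliceFirst, snocF_eq_mapDomain_add,
    coeff_sep_mul (Fin.castSucc_injective m) (fun a b _ => Subsingleton.elim a b)
      (fun a _ h => (Fin.castSucc_lt_last a).ne h),
    coeff_smul, smul_eq_mul]

end Last

/-! ### The minimal index -/

section MinIndex

variable {σ : Type*} [Fintype σ] [DecidableEq σ] {S : Type*} [CommRing S] {A : Type*} [CommRing A]
  [Algebra S A]

/-- **The numerical index of a non-zero polynomial** (Schmidt §6, Definition): if the
coefficients embed into `A`, a non-zero `P` has a non-vanishing `P_{i₀}(a)` of least weighted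
order `θ = wt r i₀`, and then `Ind P ≥ θ`. [cite: Schmidt1980, Ch. V §6 Definition] -/
theorem exists_min_wt (hinj : Function.Injective (algebraMap S A)) (a : σ → A) (r : σ → ℕ)
    {P : MvPolynomial σ S} (hP : P ≠ 0) :
    ∃ i₀, aeval a (hasseD i₀ P) ≠ 0 ∧ IndexGe P a r (wt r i₀) := by
  classical
  set T := (Finset.Iic (Finsupp.equivFunOnFinite.symm fun h => degreeOf h P)).filter
    fun i => aeval a (hasseD i P) ≠ 0 with hT
  have hmemT : ∀ i, aeval a (hasseD i P) ≠ 0 → i ∈ T := fun i hi =>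
    Finset.mem_filter.mpr ⟨mem_Iic_of_hasseD_ne_zero (fun h => degreeOf h P) (fun _ => le_rfl)
      (fun h0 => hi (by rw [h0, map_zero])), hi⟩
  have hTne : T.Nonempty := by
    obtain ⟨i, hi⟩ := exists_aeval_hasseD_ne_zero hinj a hP
    exact ⟨i, hmemT i hi⟩
  obtain ⟨i₀, hi₀, hmin⟩ := Finset.exists_min_image T (wt r) hTne
  refine ⟨i₀, (Finset.mem_filter.mp hi₀).2, fun i hi => ?_⟩
  by_contra hne
  exact absurd (hmin i (hmemT i hne)) (not_le.mpr hi)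

end MinIndex

end Roth

end Literature.NumberTheory.DiophantineGeometry
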